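import Summits.BirchSwinnertonDyer.BirchSwinnertonDyer.Theorems.InertBadSignedBranchesInertBadAtThreePointwiseKatoLever
import Summits.BirchSwinnertonDyer.BirchSwinnertonDyer.Theorems.InertBadSignedBranchesInertBadAtThreeManinOfKatoThree
import Literature.NumberTheory.EllipticCurves.ManinConstantClassCertificateTwist
import Literature.NumberTheory.EllipticCurves.ModularityVersionApProofs
import HarnessLib

/-!
# What the CM side must deliver at `p = 3`: ODD characters of PRIME conductor `ℓ ≡ 11 (mod 12)`, no Euler factors

Summit `BirchSwinnertonDyer`, crux `InertBadAtThree` (stmt-BirchSwinnertonDyer-19225; K8 `InertBadSignedBranches` r4 / BED r5), line of record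
`Lines/rubin_e1_inert_three.lean` v4 (lead `bsd-line-ibd-p1` g6; registered stub `stub_neronIntegralThreeQuartic` = the named Literature
statement F-es-18 `kato_neron_isIntegral_twistedSymbolSum_of_additive_three_polar` restricted to the quartic cell `j = 1728`). Companion of
`…InertBadAtThreePointwiseKatoLever` (p624535) and `…InertBadAtThreeManinOfNeronIntegralCMInert` (p624892). This file SHARPENS the hypothesis the
Manin conclusion `3 ∤ c` actually needs, to guide the CM-side computation (crux idea card `Ideas/rubin-e1-inert-three.md`, memo
`EPSILON-RESOLVED-bsd-idea-18-g7.md`):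

* `not_three_dvd_c_of_oddAdmissibleInstances` — the DATUM-LEVEL pointwise lever: at a lattice-optimal `X₀(N)`-datum `D` of an elliptic `W`
  with `9 ∣ N` and `W[3]` irreducible, `3 ∤ c(D)` follows from the F-es-18 conclusion for the newform `D.f` ONLY, for ODD characters `χ` of
  PRIME modulus `ℓ` ADMISSIBLE for `(W, N)` (`ℓ ∤ N`, `ℓ ≡ 11 (mod 12)`, Legendre signs at the `q ∥ N`) with `χ(3) ≠ 1` ONLY (no even
  characters, no composite moduli, no other levels) — unconditional (E-es-19 = `shiftClassGenerationThree_holds`);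
* `sq_dvd_conductorNorm_of_hasCM_of_dvd`, `primeFactors_filter_not_sq_dvd_eq_empty_of_hasCM`, `symmEuler_eq_one_of_hasCM` — a CM curve has
  no prime dividing its conductor exactly once (every bad prime is additive), so at conductor level the symmetrised Euler factor of
  F-es-18's body is the EMPTY product `1`;
* **`not_three_dvd_c_of_plainOddInstances_of_hasCM`** — for a CM curve with CM-inert bad `3` and a conductor-level lattice-optimal datum:
  `3 ∤ c` follows from the PLAIN statement «for every prime `ℓ ∤ N_W`, `ℓ ≡ 11 (mod 12)`, every odd `χ` mod `ℓ` with `χ(3) ≠ 1`, and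
  `ϖ, r` with `ϖ·Ω⁻(W) = Ω⁻_f`, `Σ_a χ(a){∞, a/ℓ}_f = r·Ω⁻_f·i`: `s·ϖ·r` is an algebraic integer for some `3 ∤ s`» — i.e. `3`-integrality,
  in Néron units, of the odd prime-conductor twisted values `τ(χ) L(W, χ̄, 1)/(Ω⁻ i)` (Birch's formula), nothing else.

HONEST FRAMING: nothing here proves any instance of F-es-18, Manin's conjecture, the crux, or BSD. No definitions; axioms standard.
-/

set_option autoImplicit false
set_option linter.dupNamespace false

noncomputable section

open scoped Classical MatrixGroups ModularForm

open CongruenceSubgroup Complex WeierstrassCurve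
  Literature.NumberTheory.EllipticCurves Literature.NumberTheory.EllipticCurves.ModularForms
  Literature.NumberTheory.EllipticCurves.Rank1Residual
  Summit.BirchSwinnertonDyer.Rank1Residual.ManinAdditive
  Summit.BirchSwinnertonDyer.BirchSwinnertonDyer.Theorems.ManinLocalTwoThree

namespace Summit.BirchSwinnertonDyer.BirchSwinnertonDyer.Theorems.InertBadSignedBranchesInertBadAtThreeOddPrimeInstances

open Summit.BirchSwinnertonDyer.Rank1Residual
open Summit.BirchSwinnertonDyer.BirchSwinnertonDyer.Theorems.InertBadSignedBranchesInertBadAtThreeManinOfKatoThree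
  (nine_dvd_conductorNorm_of_hasCM_of_not_good)
open Summit.BirchSwinnertonDyer.BirchSwinnertonDyer.Theorems.InertBadSignedBranchesInertBadAtThreePointwiseKatoLever
  (exists_int_im_shiftClass_eq_three_mul_of_oddInstances)

section Lever

variable {W : WeierstrassCurve ℚ} [W.IsElliptic] {N : ℕ} [NeZero N]

/-- **The DATUM-LEVEL pointwise Kato shift lever.** At a lattice-optimal `X₀(N)`-datum `D` of an elliptic `W` with `9 ∣ N` and `W[3]`
irreducible, `3 ∤ c(D)`, granted ONLY the F-es-18 conclusion for the newform `D.f`, odd characters `χ` of admissible prime modulus `ℓ`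
with `χ(3) ≠ 1`, all `ϖ, r` (odd branch). Unconditional (generation E-es-19 = `shiftClassGenerationThree_holds`, lattice-unit punchline
`functional_nonvanishing_gen`, hole step `exists_int_im_shiftClass_eq_three_mul_of_oddInstances`).
[cite: Kato2004Asterisque, Thm. 9.7 (p. 189)] [cite: KostersPannekoek2017, Thm. 1 (ii)] -/
theorem not_three_dvd_c_of_oddAdmissibleInstances (D : ModularParametrizationData W N)
    (hKodd : ∀ (ℓ : ℕ) [NeZero ℓ], AdmissiblePrime W N ℓ →
      ∀ χ : DirichletCharacter ℂ ℓ, χ.Odd → χ (3 : ZMod ℓ) ≠ 1 →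
        ∀ (ϖ : ℚ) (r : ℂ), (ϖ : ℝ) * W.imaginaryPeriodRat = minusPeriod D.f →
          (∏ q ∈ N.primeFactors with ¬ q ^ 2 ∣ N,
              (((q : ℂ) - (W.LFunction q : ℂ) * χ (q : ZMod ℓ)) *
                ((q : ℂ) - (W.LFunction q : ℂ) * (χ (q : ZMod ℓ))⁻¹))) *
              twistedSymbolSum D.f χ = r * (minusPeriod D.f : ℂ) * Complex.I →
          ∃ s : ℕ, ¬ 3 ∣ s ∧ IsIntegral ℤ ((s : ℂ) * ϖ * r))
    (hopt : ∀ z ∈ D.L.lattice, ∃ w ∈ periodLattice D.f, z = D.c * w) (h9 : 3 ^ 2 ∣ N)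
    (hirr : W.HasIrreducibleModPGaloisRep 3) : ¬ (3 : ℤ) ∣ D.c := by
  intro h3c
  obtain ⟨m, hm3, hspan⟩ :=
    (shiftClassGenerationThree_iff.mp shiftClassGenerationThree_holds) W D.f 0 D.isNewformOf h9 hirr
  have hpos : 0 < minusPeriod D.f :=
    IsNewform0.minusPeriod_pos_holds D.isNewformOf.1 D.isNewformOf.coeffField_eq_bot
  refine functional_nonvanishing_gen D.f
    {z | ∃ ℓ ∈ {ℓ | 0 ≤ ℓ ∧ AdmissiblePrime W N ℓ}, ∃ a : ℕ, 0 < a ∧ a < ℓ ∧ z = shiftClass D.f ℓ a}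
    m hm3 hpos hspan ?_
  rintro t ⟨ℓ, hℓadm, a, ha1, ha2, rfl⟩
  obtain ⟨hℓ, hℓN, h12, hL⟩ := hℓadm.2
  haveI : NeZero ℓ := ⟨hℓ.ne_zero⟩
  have hL' : ∀ q ∈ N.primeFactors, ¬ q ^ 2 ∣ N →
      jacobiSym (q : ℤ) ℓ = (if ((q : ℤ) * W.LFunction q) % 3 = 1 then -1 else 1) :=
    fun q hq hq2 ↦ by rw [hL q hq hq2]; rfl
  exact exists_int_im_shiftClass_eq_three_mul_of_oddInstances D hopt h9 h3c hℓ hℓN h12 hL'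
    (hKodd ℓ hℓadm.2) a ha1 ha2

end Lever

/-! ## CM curves: the symmetrised Euler factor is an empty product at conductor level -/

section CM

/-- **A CM curve has no prime dividing its conductor exactly once**: a bad prime of a CM curve is additive (no multiplicative prime,
`not_hasMultiplicativeReductionAtPrime_of_hasCM`, Silverman ATAEC II.6.4), hence `ℓ² ∣ N_W` (`sq_dvd_conductorNorm_of_not_good_of_not_mult`,
ATAEC IV.10.2(c)). [cite: SilvermanATAEC1994, Thm. II.6.4 (PDF p. 148) and IV.10.2(c)] -/
theorem sq_dvd_conductorNorm_of_hasCM_of_dvd (W : WeierstrassCurve ℚ) [W.IsElliptic] (hCM : W.HasCM)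
    {ℓ : ℕ} (hℓ : ℓ.Prime) (hdvd : ℓ ∣ W.conductorNorm ℤ) : ℓ ^ 2 ∣ W.conductorNorm ℤ := by
  haveI : Fact ℓ.Prime := ⟨hℓ⟩
  exact sq_dvd_conductorNorm_of_not_good_of_not_mult
    ⟨(W.dvd_conductorNorm_iff_not_hasGoodReductionAtPrime ℓ).mp hdvd,
      W.not_hasMultiplicativeReductionAtPrime_of_hasCM hCM ℓ⟩

/-- **No `ℓ ∥ N_W` for a CM curve**: the set of prime factors of the conductor not dividing it squared is empty.
[cite: SilvermanATAEC1994, IV.10.2(c)] -/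
theorem primeFactors_filter_not_sq_dvd_eq_empty_of_hasCM (W : WeierstrassCurve ℚ) [W.IsElliptic] (hCM : W.HasCM) :
    (W.conductorNorm ℤ).primeFactors.filter (fun ℓ ↦ ¬ ℓ ^ 2 ∣ W.conductorNorm ℤ) = ∅ := by
  refine Finset.filter_eq_empty_iff.mpr ?_
  intro ℓ hℓ hnot
  exact hnot (sq_dvd_conductorNorm_of_hasCM_of_dvd W hCM (Nat.prime_of_mem_primeFactors hℓ)
    (Nat.dvd_of_mem_primeFactors hℓ))

/-- **At conductor level the symmetrised Euler factor of F-es-18's body is `1` for a CM curve** (empty product), for every character.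
[cite: Kato2004Asterisque, Thm. 6.6 (1) (p. 163) (the factor T; here trivial)] -/
theorem symmEuler_eq_one_of_hasCM (W : WeierstrassCurve ℚ) [W.IsElliptic] (hCM : W.HasCM) {m : ℕ}
    (χ : DirichletCharacter ℂ m) :
    (∏ ℓ ∈ (W.conductorNorm ℤ).primeFactors with ¬ ℓ ^ 2 ∣ W.conductorNorm ℤ,
        (((ℓ : ℂ) - (W.LFunction ℓ : ℂ) * χ (ℓ : ZMod m)) *
          ((ℓ : ℂ) - (W.LFunction ℓ : ℂ) * (χ (ℓ : ZMod m))⁻¹))) = 1 := by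
  rw [primeFactors_filter_not_sq_dvd_eq_empty_of_hasCM W hCM, Finset.prod_empty]

/-- **What the CM side must deliver.** For a CM curve `W` with `3` inert in the CM field and bad at `3`, and a lattice-optimal
conductor-level `X₀(N_W)`-datum `D`: `3 ∤ c(D)` follows from the PLAIN `3`-integrality, in Néron units, of the ODD twisted symbol sums of
`D.f` of PRIME modulus `ℓ ∤ N_W`, `ℓ ≡ 11 (mod 12)`, for characters with `χ(3) ≠ 1` — no Euler factors (`symmEuler_eq_one_of_hasCM`), no
even characters, no composite moduli. (`9 ∣ N_W`: `nine_dvd_conductorNorm_of_hasCM_of_not_good`; `W[3]` irreducible: `X12.irr_of_cmInert`,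
Mazur 1978.) This is strictly less than the registered stub `stub_neronIntegralThreeQuartic` of line `rubin_e1_inert_three` asks for.
[cite: Kato2004Asterisque, Thm. 9.7 (p. 189)] [cite: Mazur1978, §6 Prop. 6.3 (1) (p. 153)] -/
theorem not_three_dvd_c_of_plainOddInstances_of_hasCM
    (W : WeierstrassCurve ℚ) [W.IsElliptic] [NeZero (W.conductorNorm ℤ)]
    (D : ModularParametrizationData W (W.conductorNorm ℤ))
    (hopt : ∀ z ∈ D.L.lattice, ∃ w ∈ periodLattice D.f, z = D.c * w)
    (hCM : W.HasCM) (hin : CMInert W 3) (hbad : ¬ Good W 3)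
    (hP : ∀ (ℓ : ℕ) [NeZero ℓ], ℓ.Prime → ¬ ℓ ∣ W.conductorNorm ℤ → ℓ % 12 = 11 →
      ∀ χ : DirichletCharacter ℂ ℓ, χ.Odd → χ (3 : ZMod ℓ) ≠ 1 →
        ∀ (ϖ : ℚ) (r : ℂ), (ϖ : ℝ) * W.imaginaryPeriodRat = minusPeriod D.f →
          twistedSymbolSum D.f χ = r * (minusPeriod D.f : ℂ) * Complex.I →
          ∃ s : ℕ, ¬ 3 ∣ s ∧ IsIntegral ℤ ((s : ℂ) * ϖ * r)) :
    ¬ (3 : ℤ) ∣ D.c := by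
  refine not_three_dvd_c_of_oddAdmissibleInstances D ?_ hopt
    (nine_dvd_conductorNorm_of_hasCM_of_not_good W hCM hbad) (X12.irr_of_cmInert W 3 (by norm_num) hin)
  intro ℓ _ hadm χ hχ hχ3 ϖ r hϖ hval
  rw [symmEuler_eq_one_of_hasCM W hCM χ, one_mul] at hval
  exact hP ℓ hadm.1 hadm.2.1 hadm.2.2.1 χ hχ hχ3 ϖ r hϖ hval

end CM

end Summit.BirchSwinnertonDyer.BirchSwinnertonDyer.Theorems.InertBadSignedBranchesInertBadAtThreeOddPrimeInstances

end
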